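import Summits.NavierStokesRegularity.NavierStokesRegularity.Theorems.ExtremiserTransienceTwoThirdsCellPackage
import Summits.NavierStokesRegularity.NavierStokesRegularity.Theorems.ExtremiserTransienceTwoThirdsPieceExcess
import Summits.NavierStokesRegularity.NavierStokesRegularity.Theorems.ExtremiserTransienceTwoThirdsRemainderExcess
import Summits.NavierStokesRegularity.NavierStokesRegularity.Theorems.ExtremiserTransienceTwoThirdsChebyshev
import HarnessLib

/-!
# Route `ExtremiserTransience`, crux `NearExtremalTransiencePerFlow` (stmt-NavierStokesRegularity-26567),
# LINE g10-1 «two_thirds» (ns-idea-10), stub S1a′ — BRICK 2, step (E1): THE EXCESS OF ONE TRANSLATE OF THE PACKING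

`--supports stmt-NavierStokesRegularity-26567` (helper; prover seat ns-net-p2 g13).  For one translate of the cell packing of
S1a′ — a finite family `F` of centres at mutual distance `≥ 4ρ⁸` — the total excess
`Σ_c max(J_{B_c} − κ⋆√(Z_{B_c} W_{B_c}), 0) + max(J_R − κ⋆√(Z_R W_R), 0)` (`B_c = B(c, ρ⁸)`, `R` the complement of their union)
is bounded LINEARLY: by `(κ⋆m/2 + κ⋆t/2 + m)·Z + (κ⋆m/2 + κ⋆t/2)·W` plus the layer sums `Σ_c (Z_{B(c,ρ⁸+ρ⁷)} − Z_{B_c})`,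
`Σ_c (W_{B(c,ρ⁸+ρ⁷)} − W_{B_c})`, the fat-ball sum `Σ_c (Z_{B(c,2ρ⁸)} + Z_{B(c,4ρ⁸)} + ∫_{B(c,2ρ⁸)} ‖Dw‖² + 1)` and the number of cells,
with coefficients `O(m + 1/t)`, `m = C_c/ρ²` (`translate_excess`; `t > 0` free).  The cells are tested with the pieces
`φ_c` of `cell_piece` through `piece_excess`, the remainder with `w − Σ_c φ_c` through `remainder_excess`; the per-cell bounds are put in
affine normal form (`cell_affine`, `remainder_affine`) and summed.  Also: `∫ ‖Dw‖² ≤ Z` for divergence-free `w`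
(`integral_norm_fderiv_sq_le_Zen`) and the bookkeeping of integrals over separated balls and their complement.
HONEST FRAMING: a linear excess bound for one translate; nothing about Navier–Stokes is proved; no summit is proved by a line. [folklore]
-/

noncomputable section

open scoped Topology InnerProductSpace RealInnerProductSpace ENNReal NNReal ContDiff
open MeasureTheory Filter Set Metric
open Literature.Analysis.FluidPDE
open Summit.NavierStokesRegularity.NavierStokesRegularity.Theorems.DepletionLadder.KStar.HalfSpace
open Summit.NavierStokesRegularity.NavierStokesRegularity.Theorems.NearExtremalTransiencePerFlow.LocalMaximiser

namespace Summit.NavierStokesRegularity.NavierStokesRegularity.Theorems.NearExtremalTransiencePerFlow.TwoThirds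

-- the summit's namespace repeats the problem name by convention (D-0017)
set_option linter.dupNamespace false

/-! ## `∫ ‖Dw‖² ≤ Z` for divergence-free fields -/

/-- **`∫ ‖Dw‖² ≤ ∫ ‖curl w‖²`** for a smooth divergence-free `L²` field with `Dw ∈ L²` (operator norm `≤` Frobenius norm and the
tree's `∫ |Dw|²_F ≤ ∫ |curl w|²`). [folklore] -/
theorem integral_norm_fderiv_sq_le_Zen {w : E3 → E3} (hw : ContDiff ℝ (⊤ : ℕ∞) w) (hdiv : VectorCalculus.IsDivFree w)
    (h0 : ∫⁻ x, ‖iteratedFDeriv ℝ 0 w x‖ₑ ^ 2 < ⊤) (h1 : ∫⁻ x, ‖iteratedFDeriv ℝ 1 w x‖ₑ ^ 2 < ⊤) :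
    Integrable (fun x => ‖fderiv ℝ w x‖ ^ 2) ∧ ∫ x, ‖fderiv ℝ w x‖ ^ 2 ≤ Zen w := by
  have hw2 : ContDiff ℝ 2 w := hw.of_le (by norm_cast)
  have hDc : Continuous (fderiv ℝ w) := hw.continuous_fderiv (by simp)
  have hL2 : ∫⁻ x, ‖w x‖ₑ ^ 2 < ⊤ := by
    have h : ∫⁻ x, ‖w x‖ₑ ^ 2 = ∫⁻ x, ‖iteratedFDeriv ℝ 0 w x‖ₑ ^ 2 :=
      lintegral_congr fun x => by rw [← ofReal_norm (iteratedFDeriv ℝ 0 w x), norm_iteratedFDeriv_zero, ofReal_norm]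
    rw [h]; exact h0
  have hD2 : ∫⁻ x, ‖fderiv ℝ w x‖ₑ ^ 2 < ⊤ := by
    have h : ∫⁻ x, ‖fderiv ℝ w x‖ₑ ^ 2 = ∫⁻ x, ‖iteratedFDeriv ℝ 1 w x‖ₑ ^ 2 :=
      lintegral_congr fun x => by rw [← ofReal_norm (iteratedFDeriv ℝ 1 w x), norm_iteratedFDeriv_one, ofReal_norm]
    rw [h]; exact h1
  have hint : Integrable (fun x => ‖fderiv ℝ w x‖ ^ 2) := integrable_sq_norm_of_lintegral_lt_top hDc hD2
  refine ⟨hint, ?_⟩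
  have izd : Integrable (zd w) := (integrable_norm_curl_sq hw2 h1).1
  have hωc : Continuous (curl w) := (contDiff_curl (n := 1) (by exact_mod_cast hw2)).continuous
  have hfin : ∫⁻ x, ‖curl w x‖ₑ ^ 2 < ⊤ := by
    have h := hasFiniteIntegral_iff_enorm.1 izd.2
    refine lt_of_le_of_lt (le_of_eq (lintegral_congr fun x => ?_)) h
    change ‖curl w x‖ₑ ^ 2 = ‖‖curl w x‖ ^ 2‖ₑ
    rw [Real.enorm_eq_ofReal (sq_nonneg _), ENNReal.ofReal_pow (norm_nonneg _), ofReal_norm]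
  have hle : ∫⁻ x, ‖fderiv ℝ w x‖ₑ ^ 2 ≤ ∫⁻ x, ‖curl w x‖ₑ ^ 2 := by
    calc ∫⁻ x, ‖fderiv ℝ w x‖ₑ ^ 2 ≤ ∫⁻ x, ENNReal.ofReal (frobeniusNormSq (fderiv ℝ w x)) := by
          refine lintegral_mono fun x => ?_
          rw [show ‖fderiv ℝ w x‖ₑ ^ 2 = ENNReal.ofReal (‖fderiv ℝ w x‖ ^ 2) by
            rw [← ofReal_norm, ENNReal.ofReal_pow (norm_nonneg _)]]
          exact ENNReal.ofReal_le_ofReal (sq_opNorm_le_frobeniusNormSq _)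
      _ ≤ ∫⁻ x, ‖curl w x‖ₑ ^ 2 := lintegral_frobeniusNormSq_fderiv_le_lintegral_sq_norm_curl hw2 hdiv hL2
  unfold Zen
  rw [integral_sq_norm_eq_toReal hDc, integral_sq_norm_eq_toReal hωc]
  exact ENNReal.toReal_mono hfin.ne hle

/-! ## Integrals over separated balls and their complement -/

/-- `Σ_c ∫_{B(c,r)} f ≤ ∫ f` for `f ≥ 0` integrable and `2r`-separated centres. [folklore] -/
theorem sum_setIntegral_ball_le {f : E3 → ℝ} (hf : Integrable f) (hf0 : ∀ x, 0 ≤ f x) (F : Finset E3) {r : ℝ}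
    (hsep : ∀ c ∈ F, ∀ c' ∈ F, c ≠ c' → 2 * r ≤ dist c c') :
    ∑ c ∈ F, ∫ x in ball c r, f x ≤ ∫ x, f x := by
  rw [integral_eq_sum_balls_add_compl hf F hsep]
  have h : 0 ≤ ∫ x in (⋃ c ∈ F, ball c r)ᶜ, f x :=
    setIntegral_nonneg (Finset.measurableSet_biUnion _ fun c _ => measurableSet_ball).compl fun x _ => hf0 x
  linarith

/-- The complement integrals of two nested separated packings differ by the sum of the layers. [folklore] -/
theorem compl_integral_sub_eq {f : E3 → ℝ} (hf : Integrable f) (F : Finset E3) {r r' : ℝ}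
    (hsep : ∀ c ∈ F, ∀ c' ∈ F, c ≠ c' → 2 * r ≤ dist c c') (hsep' : ∀ c ∈ F, ∀ c' ∈ F, c ≠ c' → 2 * r' ≤ dist c c') :
    (∫ x in (⋃ c ∈ F, ball c r)ᶜ, f x) - (∫ x in (⋃ c ∈ F, ball c r')ᶜ, f x) =
      ∑ c ∈ F, ((∫ x in ball c r', f x) - ∫ x in ball c r, f x) := by
  have h1 := integral_eq_sum_balls_add_compl hf F hsep
  have h2 := integral_eq_sum_balls_add_compl hf F hsep'
  rw [Finset.sum_sub_distrib]
  linarith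

/-! ## Affine normal forms -/

/-- The per-cell bound of `piece_excess` (`j₁ = m₃ = m`, `j₂ = m·S`) in affine normal form. [folklore] -/
theorem cell_affine {κ m t A₁ Zb Wb ZL WL S x : ℝ} (hκ : 0 ≤ κ) (hm : 0 ≤ m) (ht : 0 < t) (hA₁ : 0 ≤ A₁)
    (hZb : 0 ≤ Zb) (hWb : 0 ≤ Wb) (hZL : 0 ≤ ZL) (hWL : 0 ≤ WL) (hS : 0 ≤ S)
    (hx : x ≤ κ * (m / 2 * (Zb + (2 * ZL + 2 * m) + Wb + (2 * WL + 6 * (m * S))) + t / 2 * (Zb + Wb) +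
        (1 / (2 * t) + 1 / 2) * ((2 * ZL + 2 * m) + (2 * WL + 6 * (m * S)))) + (2 * A₁ * ZL + 2 * A₁ * m) +
        m * (Zb + (2 * ZL + 2 * m))) :
    max x 0 ≤ (κ * m / 2 + κ * t / 2 + m) * Zb + (κ * m / 2 + κ * t / 2) * Wb +
      (κ * m + 2 * κ * (1 / (2 * t) + 1 / 2) + 2 * A₁ + 2 * m) * ZL + (κ * m + 2 * κ * (1 / (2 * t) + 1 / 2)) * WL +
      (3 * κ * m ^ 2 + 6 * κ * (1 / (2 * t) + 1 / 2) * m) * S +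
      (κ * m ^ 2 + 2 * κ * (1 / (2 * t) + 1 / 2) * m + 2 * A₁ * m + 2 * m ^ 2) := by
  have hct : 0 ≤ 1 / (2 * t) + 1 / 2 := by positivity
  refine max_le (le_of_le_of_eq hx (by ring)) ?_
  positivity

/-- The remainder bound of `remainder_excess` in affine normal form. [folklore] -/
theorem remainder_affine {κ m t A₁ ZR ZR' WR WR' N SS x : ℝ} (hκ : 0 ≤ κ) (hm : 0 ≤ m) (ht : 0 < t) (hA₁ : 0 ≤ A₁)
    (hZR' : 0 ≤ ZR') (hWR' : 0 ≤ WR') (hZL : ZR' ≤ ZR) (hWL : WR' ≤ WR) (hN : 0 ≤ N) (hSS : 0 ≤ SS)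
    (hx : x ≤ κ * (m / 2 * (ZR' + (2 * (ZR - ZR') + 2 * (N * m)) + WR' + (2 * (WR - WR') + 6 * (m * SS))) +
        t / 2 * (ZR' + WR') +
        (1 / (2 * t) + 1 / 2) * ((2 * (ZR - ZR') + 2 * (N * m)) + (2 * (WR - WR') + 6 * (m * SS)))) +
        (2 * A₁ * (ZR - ZR') + 2 * A₁ * (N * m)) + m * (ZR' + (2 * (ZR - ZR') + 2 * (N * m))) + A₁ * (ZR - ZR')) :
    max x 0 ≤ (κ * m / 2 + κ * t / 2 + m) * ZR' + (κ * m / 2 + κ * t / 2) * WR' +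
      (κ * m + 2 * κ * (1 / (2 * t) + 1 / 2) + 3 * A₁ + 2 * m) * (ZR - ZR') + (κ * m + 2 * κ * (1 / (2 * t) + 1 / 2)) * (WR - WR') +
      (3 * κ * m ^ 2 + 6 * κ * (1 / (2 * t) + 1 / 2) * m) * SS +
      N * (κ * m ^ 2 + 2 * κ * (1 / (2 * t) + 1 / 2) * m + 2 * A₁ * m + 2 * m ^ 2) := by
  have hct : 0 ≤ 1 / (2 * t) + 1 / 2 := by positivity
  have h1 : 0 ≤ ZR - ZR' := by linarith
  have h2 : 0 ≤ WR - WR' := by linarith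
  refine max_le (le_of_le_of_eq hx (by ring)) ?_
  positivity

/-- Summing an affine form over the cells. [folklore] -/
theorem sum_affine (F : Finset E3) (a b c d e k : ℝ) (Zb Wb ZL WL S : E3 → ℝ) :
    ∑ i ∈ F, (a * Zb i + b * Wb i + c * ZL i + d * WL i + e * S i + k) =
      a * ∑ i ∈ F, Zb i + b * ∑ i ∈ F, Wb i + c * ∑ i ∈ F, ZL i + d * ∑ i ∈ F, WL i + e * ∑ i ∈ F, S i + F.card * k := by
  simp only [Finset.sum_add_distrib, ← Finset.mul_sum, Finset.sum_const, nsmul_eq_mul]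

/-! ## The excess of one translate -/

/-- **THE EXCESS OF ONE TRANSLATE OF THE PACKING** (see the module docstring): a linear bound, uniform in the admissible field. [folklore] -/
theorem translate_excess (A₁ A_E : ℝ) (hA₁ : 0 ≤ A₁) (hAE : 0 ≤ A_E) :
    ∃ Cc : ℝ, 0 ≤ Cc ∧ ∀ (w : E3 → E3) (F : Finset E3) (ρ t : ℝ),
    ContDiff ℝ (⊤ : ℕ∞) w → VectorCalculus.IsDivFree w → (∀ x, ‖w x‖ ≤ 1) → (∀ x, ‖fderiv ℝ w x‖ ≤ A₁) →
    HasLinearGrowth A_E w → (∫⁻ x, ‖iteratedFDeriv ℝ 0 w x‖ₑ ^ 2 < ⊤) → (∫⁻ x, ‖iteratedFDeriv ℝ 1 w x‖ₑ ^ 2 < ⊤) →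
    (∫⁻ x, ‖iteratedFDeriv ℝ 2 w x‖ₑ ^ 2 < ⊤) → 2 ≤ ρ → 0 < t →
    (∀ c ∈ F, ∀ c' ∈ F, c ≠ c' → 4 * ρ ^ 8 ≤ dist c c') →
    (∑ c ∈ F, max (Jb w c (ρ ^ 8) - kStar * Real.sqrt (Zb w c (ρ ^ 8) * Wb w c (ρ ^ 8))) 0) +
      max ((∫ x in (⋃ c ∈ F, ball c (ρ ^ 8))ᶜ, sd w x) -
        kStar * Real.sqrt ((∫ x in (⋃ c ∈ F, ball c (ρ ^ 8))ᶜ, zd w x) * (∫ x in (⋃ c ∈ F, ball c (ρ ^ 8))ᶜ, wd w x))) 0 ≤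
      (kStar * (Cc / ρ ^ 2) / 2 + kStar * t / 2 + Cc / ρ ^ 2) * Zen w + (kStar * (Cc / ρ ^ 2) / 2 + kStar * t / 2) * Wpa w +
      (2 * (kStar * (Cc / ρ ^ 2)) + 4 * kStar * (1 / (2 * t) + 1 / 2) + 5 * A₁ + 4 * (Cc / ρ ^ 2)) *
        ∑ c ∈ F, (Zb w c (ρ ^ 8 + ρ ^ 7) - Zb w c (ρ ^ 8)) +
      (2 * (kStar * (Cc / ρ ^ 2)) + 4 * kStar * (1 / (2 * t) + 1 / 2)) * ∑ c ∈ F, (Wb w c (ρ ^ 8 + ρ ^ 7) - Wb w c (ρ ^ 8)) +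
      (6 * kStar * (Cc / ρ ^ 2) ^ 2 + 12 * kStar * (1 / (2 * t) + 1 / 2) * (Cc / ρ ^ 2)) *
        ∑ c ∈ F, (Zb w c (2 * ρ ^ 8) + Zb w c (4 * ρ ^ 8) + (∫ x in ball c (2 * ρ ^ 8), ‖fderiv ℝ w x‖ ^ 2) + 1) +
      2 * F.card * (kStar * (Cc / ρ ^ 2) ^ 2 + 2 * kStar * (1 / (2 * t) + 1 / 2) * (Cc / ρ ^ 2) + 2 * A₁ * (Cc / ρ ^ 2) +
        2 * (Cc / ρ ^ 2) ^ 2) := by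
  obtain ⟨Cc, hCc0, hcell⟩ := cell_piece A₁ A_E hA₁ hAE
  refine ⟨Cc, hCc0, fun w F ρ t hw hdiv hw1 hDw hgr h0 h1 h2 hρ ht hsep => ?_⟩
  have hρ0 : 0 < ρ := by linarith
  have hρ1 : 1 ≤ ρ := by linarith
  have hκ : 0 ≤ kStar := kStar_pos.le
  have hm : 0 ≤ Cc / ρ ^ 2 := by positivity
  have hw2 : ContDiff ℝ 2 w := hw.of_le (by norm_cast)
  have hw3 : ContDiff ℝ 3 w := hw.of_le (by norm_cast)
  -- the pieces of the cells
  choose φ χ hφs hφc hφdiv hφsupp hχc hχ01 hχone hχout hχsupp hd0 hd0' hd1 hd1' he1 hi1 hj1 he2 hi2 hj2 using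
    fun c => hcell w c ρ hw hdiv hw1 hDw hgr hρ
  -- separations
  have hρ78 : ρ ^ 7 ≤ ρ ^ 8 := pow_le_pow_right₀ hρ1 (by norm_num)
  have hρ8 : 0 < ρ ^ 8 := by positivity
  have hsep1 : ∀ c ∈ F, ∀ c' ∈ F, c ≠ c' → 2 * ρ ^ 8 ≤ dist c c' := fun c hc c' hc' hne => by
    linarith [hsep c hc c' hc' hne]
  have hsep2 : ∀ c ∈ F, ∀ c' ∈ F, c ≠ c' → 2 * (ρ ^ 8 + ρ ^ 7) ≤ dist c c' := fun c hc c' hc' hne => by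
    linarith [hsep c hc c' hc' hne]
  have hsep3 : ∀ c ∈ F, ∀ c' ∈ F, c ≠ c' → 2 * (3 / 2 * ρ ^ 8) ≤ dist c c' := fun c hc c' hc' hne => by
    linarith [hsep c hc c' hc' hne]
  -- integrability and the partition identities
  have izd : Integrable (zd w) := (integrable_norm_curl_sq hw2 h1).1
  have iwd : Integrable (wd w) := (integrable_frobeniusNormSq_fderiv_curl hw3 h2).1
  have hZ1 : Zen w = (∑ c ∈ F, Zb w c (ρ ^ 8)) + ∫ x in (⋃ c ∈ F, ball c (ρ ^ 8))ᶜ, zd w x :=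
    integral_eq_sum_balls_add_compl izd F hsep1
  have hZ2 : Zen w = (∑ c ∈ F, Zb w c (ρ ^ 8 + ρ ^ 7)) + ∫ x in (⋃ c ∈ F, ball c (ρ ^ 8 + ρ ^ 7))ᶜ, zd w x :=
    integral_eq_sum_balls_add_compl izd F hsep2
  have hW1 : Wpa w = (∑ c ∈ F, Wb w c (ρ ^ 8)) + ∫ x in (⋃ c ∈ F, ball c (ρ ^ 8))ᶜ, wd w x :=
    integral_eq_sum_balls_add_compl iwd F hsep1
  have hW2 : Wpa w = (∑ c ∈ F, Wb w c (ρ ^ 8 + ρ ^ 7)) + ∫ x in (⋃ c ∈ F, ball c (ρ ^ 8 + ρ ^ 7))ᶜ, wd w x :=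
    integral_eq_sum_balls_add_compl iwd F hsep2
  have hLz : (∫ x in (⋃ c ∈ F, ball c (ρ ^ 8))ᶜ, zd w x) - (∫ x in (⋃ c ∈ F, ball c (ρ ^ 8 + ρ ^ 7))ᶜ, zd w x) =
      ∑ c ∈ F, (Zb w c (ρ ^ 8 + ρ ^ 7) - Zb w c (ρ ^ 8)) := compl_integral_sub_eq izd F hsep1 hsep2
  have hLw : (∫ x in (⋃ c ∈ F, ball c (ρ ^ 8))ᶜ, wd w x) - (∫ x in (⋃ c ∈ F, ball c (ρ ^ 8 + ρ ^ 7))ᶜ, wd w x) =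
      ∑ c ∈ F, (Wb w c (ρ ^ 8 + ρ ^ 7) - Wb w c (ρ ^ 8)) := compl_integral_sub_eq iwd F hsep1 hsep2
  -- signs
  have hlay : ∀ c : E3, ball c (ρ ^ 8) ⊆ ball c (ρ ^ 8 + ρ ^ 7) := fun c => ball_subset_ball (le_add_of_nonneg_right (by positivity))
  have hZL0 : ∀ c : E3, 0 ≤ Zb w c (ρ ^ 8 + ρ ^ 7) - Zb w c (ρ ^ 8) := fun c => by linarith [Zb_mono hw (hlay c)]
  have hWL0 : ∀ c : E3, 0 ≤ Wb w c (ρ ^ 8 + ρ ^ 7) - Wb w c (ρ ^ 8) := fun c => by linarith [Wb_mono hw (hlay c)]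
  have hD0 : ∀ c : E3, 0 ≤ ∫ x in ball c (2 * ρ ^ 8), ‖fderiv ℝ w x‖ ^ 2 := fun c =>
    setIntegral_nonneg measurableSet_ball fun x _ => sq_nonneg _
  have hS0 : ∀ c : E3, 0 ≤ Zb w c (2 * ρ ^ 8) + Zb w c (4 * ρ ^ 8) + (∫ x in ball c (2 * ρ ^ 8), ‖fderiv ℝ w x‖ ^ 2) + 1 := fun c => by
    have := Zb_nonneg w c (2 * ρ ^ 8); have := Zb_nonneg w c (4 * ρ ^ 8); have := hD0 c; positivity
  have hsumZL0 : 0 ≤ ∑ c ∈ F, (Zb w c (ρ ^ 8 + ρ ^ 7) - Zb w c (ρ ^ 8)) := Finset.sum_nonneg fun c _ => hZL0 c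
  have hsumWL0 : 0 ≤ ∑ c ∈ F, (Wb w c (ρ ^ 8 + ρ ^ 7) - Wb w c (ρ ^ 8)) := Finset.sum_nonneg fun c _ => hWL0 c
  have hsumZb0 : 0 ≤ ∑ c ∈ F, Zb w c (ρ ^ 8) := Finset.sum_nonneg fun c _ => Zb_nonneg w c _
  have hsumWb0 : 0 ≤ ∑ c ∈ F, Wb w c (ρ ^ 8) := Finset.sum_nonneg fun c _ => Wb_nonneg w c _
  have hUm : MeasurableSet (⋃ c ∈ F, ball c (ρ ^ 8 + ρ ^ 7))ᶜ := (Finset.measurableSet_biUnion _ fun c _ => measurableSet_ball).compl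
  have hZR'0 : 0 ≤ ∫ x in (⋃ c ∈ F, ball c (ρ ^ 8 + ρ ^ 7))ᶜ, zd w x := setIntegral_nonneg hUm fun x _ => sq_nonneg _
  have hWR'0 : 0 ≤ ∫ x in (⋃ c ∈ F, ball c (ρ ^ 8 + ρ ^ 7))ᶜ, wd w x := setIntegral_nonneg hUm fun x _ => frobeniusNormSq_nonneg _
  -- the cells
  have hcellb : ∀ c ∈ F, max (Jb w c (ρ ^ 8) - kStar * Real.sqrt (Zb w c (ρ ^ 8) * Wb w c (ρ ^ 8))) 0 ≤
      (kStar * (Cc / ρ ^ 2) / 2 + kStar * t / 2 + Cc / ρ ^ 2) * Zb w c (ρ ^ 8) + (kStar * (Cc / ρ ^ 2) / 2 + kStar * t / 2) * Wb w c (ρ ^ 8) +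
      (kStar * (Cc / ρ ^ 2) + 2 * kStar * (1 / (2 * t) + 1 / 2) + 2 * A₁ + 2 * (Cc / ρ ^ 2)) * (Zb w c (ρ ^ 8 + ρ ^ 7) - Zb w c (ρ ^ 8)) +
      (kStar * (Cc / ρ ^ 2) + 2 * kStar * (1 / (2 * t) + 1 / 2)) * (Wb w c (ρ ^ 8 + ρ ^ 7) - Wb w c (ρ ^ 8)) +
      (3 * kStar * (Cc / ρ ^ 2) ^ 2 + 6 * kStar * (1 / (2 * t) + 1 / 2) * (Cc / ρ ^ 2)) *
        (Zb w c (2 * ρ ^ 8) + Zb w c (4 * ρ ^ 8) + (∫ x in ball c (2 * ρ ^ 8), ‖fderiv ℝ w x‖ ^ 2) + 1) +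
      (kStar * (Cc / ρ ^ 2) ^ 2 + 2 * kStar * (1 / (2 * t) + 1 / 2) * (Cc / ρ ^ 2) + 2 * A₁ * (Cc / ρ ^ 2) + 2 * (Cc / ρ ^ 2) ^ 2) := by
    intro c _
    have hM : ∀ x, ‖φ c x‖ ≤ 1 + Cc / ρ ^ 2 := fun x => by
      have hχw : ‖χ c x • w x‖ ≤ 1 := by
        rw [norm_smul, Real.norm_eq_abs, abs_of_nonneg (hχ01 c x).1]
        calc χ c x * ‖w x‖ ≤ 1 * 1 := mul_le_mul (hχ01 c x).2 (hw1 x) (norm_nonneg _) zero_le_one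
          _ = 1 := one_mul 1
      calc ‖φ c x‖ = ‖(φ c x - χ c x • w x) + χ c x • w x‖ := by rw [sub_add_cancel]
        _ ≤ ‖φ c x - χ c x • w x‖ + ‖χ c x • w x‖ := norm_add_le _ _
        _ ≤ Cc / ρ ^ 2 + 1 := add_le_add (hd0 c x) hχw
        _ = 1 + Cc / ρ ^ 2 := add_comm _ _
    have hj2' : ∫ x, ‖fderiv ℝ (curl (φ c)) x - χ c x • fderiv ℝ (curl w) x‖ ^ 2 ≤
        Cc / ρ ^ 2 * (Zb w c (2 * ρ ^ 8) + Zb w c (4 * ρ ^ 8) + (∫ x in ball c (2 * ρ ^ 8), ‖fderiv ℝ w x‖ ^ 2) + 1) :=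
      (hj2 c).trans (le_of_eq (by ring))
    have hx := piece_excess (c := c) (R := ρ ^ 8) (ℓ := ρ ^ 7) hw hDw h1 h2 (hφs c) (hφc c) (hφdiv c) hm hM (by positivity)
      (hχc c) (hχ01 c) (hχone c) (hχout c) (he1 c) (hi1 c) (hj1 c) (he2 c) (hi2 c) hj2' hm (hd1 c) ht
    exact cell_affine hκ hm ht hA₁ (Zb_nonneg w c _) (Wb_nonneg w c _) (hZL0 c) (hWL0 c) (hS0 c) hx
  have hcells := Finset.sum_le_sum hcellb
  rw [sum_affine] at hcells
  -- the remainder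
  have hsum6 : ∑ c ∈ F, Cc * (Zb w c (2 * ρ ^ 8) + Zb w c (4 * ρ ^ 8) + (∫ x in ball c (2 * ρ ^ 8), ‖fderiv ℝ w x‖ ^ 2) + 1) / ρ ^ 2 =
      Cc / ρ ^ 2 * ∑ c ∈ F, (Zb w c (2 * ρ ^ 8) + Zb w c (4 * ρ ^ 8) + (∫ x in ball c (2 * ρ ^ 8), ‖fderiv ℝ w x‖ ^ 2) + 1) := by
    rw [Finset.mul_sum]
    exact Finset.sum_congr rfl fun c _ => by ring
  have hR := remainder_excess (S := fun c => Zb w c (2 * ρ ^ 8) + Zb w c (4 * ρ ^ 8) + (∫ x in ball c (2 * ρ ^ 8), ‖fderiv ℝ w x‖ ^ 2) + 1)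
    hρ hCc0 hsep3 hw hdiv hw1 hDw h0 h1 h2 (fun c _ => hφs c) (fun c _ => hφsupp c) (fun c _ => hφdiv c) (fun c _ => hχc c)
    (fun c _ => hχ01 c) (fun c _ => hχone c) (fun c _ => hχout c) (fun c _ => hχsupp c) (fun c _ => hd0 c) (fun c _ => hd0' c)
    (fun c _ => hd1 c) (fun c _ => hd1' c) (fun c _ => he1 c) (fun c _ => hi1 c) (fun c _ => hj1 c) (fun c _ => he2 c)
    (fun c _ => hi2 c) (fun c _ => hj2 c) ht
  rw [hsum6] at hR
  have hZRle : (∫ x in (⋃ c ∈ F, ball c (ρ ^ 8 + ρ ^ 7))ᶜ, zd w x) ≤ ∫ x in (⋃ c ∈ F, ball c (ρ ^ 8))ᶜ, zd w x := by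
    linarith
  have hWRle : (∫ x in (⋃ c ∈ F, ball c (ρ ^ 8 + ρ ^ 7))ᶜ, wd w x) ≤ ∫ x in (⋃ c ∈ F, ball c (ρ ^ 8))ᶜ, wd w x := by
    linarith
  have hN0 : (0 : ℝ) ≤ F.card := Nat.cast_nonneg _
  have hSS0 : 0 ≤ ∑ c ∈ F, (Zb w c (2 * ρ ^ 8) + Zb w c (4 * ρ ^ 8) + (∫ x in ball c (2 * ρ ^ 8), ‖fderiv ℝ w x‖ ^ 2) + 1) :=
    Finset.sum_nonneg fun c _ => hS0 c
  have hRb := remainder_affine hκ hm ht hA₁ hZR'0 hWR'0 hZRle hWRle hN0 hSS0 hR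
  rw [hLz, hLw] at hRb
  -- totals: the cells and the outer region together carry at most `Z` resp. `W`
  have hct : 0 ≤ 1 / (2 * t) + 1 / 2 := by positivity
  have g1 : 0 ≤ (kStar * (Cc / ρ ^ 2) / 2 + kStar * t / 2 + Cc / ρ ^ 2) *
      (Zen w - (∑ c ∈ F, Zb w c (ρ ^ 8)) - ∫ x in (⋃ c ∈ F, ball c (ρ ^ 8 + ρ ^ 7))ᶜ, zd w x) :=
    mul_nonneg (by positivity) (by linarith)
  have g2 : 0 ≤ (kStar * (Cc / ρ ^ 2) / 2 + kStar * t / 2) *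
      (Wpa w - (∑ c ∈ F, Wb w c (ρ ^ 8)) - ∫ x in (⋃ c ∈ F, ball c (ρ ^ 8 + ρ ^ 7))ᶜ, wd w x) :=
    mul_nonneg (by positivity) (by linarith)
  linarith only [hcells, hRb, g1, g2]

end Summit.NavierStokesRegularity.NavierStokesRegularity.Theorems.NearExtremalTransiencePerFlow.TwoThirds

end
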